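import Literature.Analysis.FluidPDE.ElgindiHkClosure
import Literature.Analysis.FluidPDE.ElgindiL12SupBound
import Literature.Analysis.FluidPDE.ElgindiHkTools
import Mathlib.MeasureTheory.Integral.Prod
import HarnessLib

/-!
# `L₁₂` on the `𝓗⁰` class and its continuity along `𝓗⁴`-approximating sequences
([Elgindi2021] §1.7.2 and §7.5: `|L₁₂(f)| ≲ |f|_{𝓗⁰}`)

Topic `Literature/Analysis/FluidPDE`. Support file (definitions with bodies and proved theorems, no
named facts) on the proof path of the named fact
`Literature.Analysis.FluidPDE.Elgindi.ElgindiGhoulMasmoudi2021_stabilityCore`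
(`ElgindiStabilityDecomposition.lean`). T. M. Elgindi, Ann. of Math. 194 (2021) =
arXiv:1904.04795, §1.7.2 (p. 7, the definition of `L₁₂`) and §7.5 (p. 24, `|L₁₂(F)| ≲ |F|_{𝓗⁰}`).

For `h` continuous on the open strip with `|h|_{𝓗⁰} < ∞` the integrand `h(r,θ)K(θ)/r` of
`L₁₂(h)(z) = ∫_{r>z}∫₀^{π/2} hK/r` is integrable on `{r > z} × (0, π/2)` for `z ≥ 0` (Cauchy–Schwarz
against `K/(r·hWeight) ∈ L²(strip)`), `L₁₂(h)(z)` is the corresponding double integral, and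
`|L₁₂(h)(z)| ≤ 6|h|_{𝓗⁰}`. Consequently `L₁₂(f_n)(z) → L₁₂(F)(z)` (`z ≥ 0`) along any
`𝓗⁴`-approximating sequence `f_n → F` (`HkApprox.tendsto_L12`).
-/

noncomputable section

open MeasureTheory Set Function Real Filter
open _root_.Topology
open scoped ENNReal ContDiff

namespace Literature.Analysis.FluidPDE

namespace Elgindi

/-- The region of integration of `L₁₂(·)(z)`: `{r > z} × (0, π/2)`. [folklore] -/
def L12Region (z : ℝ) : Set (ℝ × ℝ) := Ioi z ×ˢ Ioo (0:ℝ) (π / 2)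

/-- `L12Region z` is measurable. [folklore] -/
theorem measurableSet_L12Region (z : ℝ) : MeasurableSet (L12Region z) := measurableSet_Ioi.prod measurableSet_Ioo

/-- `L12Region z ⊆ strip` for `z ≥ 0`. [folklore] -/
theorem L12Region_subset_strip {z : ℝ} (hz : 0 ≤ z) : L12Region z ⊆ strip :=
  fun _ hp => ⟨lt_of_le_of_lt hz hp.1, hp.2⟩

/-- `w ≤ hWeight` on the strip (`sin(2θ)^{η/2} ≤ 1`). [folklore] -/
theorem radialWeight_le_hWeight {p : ℝ × ℝ} (hp : p ∈ strip) : radialWeight p.1 ≤ hWeight p.1 p.2 := by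
  have hs : 0 < Real.sin (2 * p.2) := Real.sin_pos_of_pos_of_lt_pi (by linarith [hp.2.1]) (by linarith [hp.2.2])
  have hsle : Real.sin (2 * p.2) ^ (eta / 2) ≤ 1 := Real.rpow_le_one hs.le (Real.sin_le_one _) (by unfold eta; norm_num)
  have hw : 0 < radialWeight p.1 := radialWeight_pos hp.1
  unfold hWeight
  rw [le_div_iff₀ (Real.rpow_pos_of_pos hs _)]
  nlinarith

/-- **The kernel `K/(r·hWeight)` is square integrable on the strip**: `∫∫ (K/(r hW))² ≤ 36`. [cite: Elgindi2021, §7.5 (p. 24 of arXiv:1904.04795)] -/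
theorem lintegral_kernel_div_sq_le :
    ∫⁻ p in strip, ENNReal.ofReal ((kernelK p.2 / (p.1 * hWeight p.1 p.2)) ^ 2) ≤ 36 := by
  calc ∫⁻ p in strip, ENNReal.ofReal ((kernelK p.2 / (p.1 * hWeight p.1 p.2)) ^ 2)
      ≤ ∫⁻ p in strip, ENNReal.ofReal (9 * (1 / (p.1 ^ 2 * radialWeight p.1 ^ 2))) * 1 := by
        refine setLIntegral_mono' measurableSet_strip fun p hp => ?_
        rw [mul_one]
        refine ENNReal.ofReal_le_ofReal ?_
        have hr : 0 < p.1 := hp.1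
        have hw : 0 < radialWeight p.1 := radialWeight_pos hr
        have hW : radialWeight p.1 ≤ hWeight p.1 p.2 := radialWeight_le_hWeight hp
        have hK : |kernelK p.2| ≤ 3 := abs_kernelK_le p.2
        rw [div_pow, ← sq_abs (kernelK p.2)]
        have hK2 : |kernelK p.2| ^ 2 ≤ 9 := by nlinarith [abs_nonneg (kernelK p.2)]
        have hden : p.1 ^ 2 * radialWeight p.1 ^ 2 ≤ (p.1 * hWeight p.1 p.2) ^ 2 := by
          rw [mul_pow]; exact mul_le_mul_of_nonneg_left (pow_le_pow_left₀ hw.le hW 2) (sq_nonneg _)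
        have hpos : 0 < p.1 ^ 2 * radialWeight p.1 ^ 2 := by positivity
        calc |kernelK p.2| ^ 2 / (p.1 * hWeight p.1 p.2) ^ 2 ≤ 9 / (p.1 * hWeight p.1 p.2) ^ 2 := by gcongr
          _ ≤ 9 / (p.1 ^ 2 * radialWeight p.1 ^ 2) := by gcongr
          _ = 9 * (1 / (p.1 ^ 2 * radialWeight p.1 ^ 2)) := by ring
    _ = (∫⁻ r in Ioi 0, ENNReal.ofReal (9 * (1 / (r ^ 2 * radialWeight r ^ 2)))) * ∫⁻ _ in Ioo 0 (π / 2), (1:ℝ≥0∞) := by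
        refine lintegral_strip_tensor (a := fun r => ENNReal.ofReal (9 * (1 / (r ^ 2 * radialWeight r ^ 2)))) (b := fun _ => 1) ?_ aemeasurable_const
        have hc : ContinuousOn (fun r : ℝ => 9 * (1 / (r ^ 2 * radialWeight r ^ 2))) (Ioi 0) := by
          refine continuousOn_const.mul (continuousOn_const.div ?_ fun r hr => ?_)
          · unfold radialWeight
            exact (continuousOn_id.pow 2).mul ((ContinuousOn.div (by fun_prop) (by fun_prop) fun r hr => pow_ne_zero 2 (ne_of_gt hr)).pow 2)
          · exact mul_ne_zero (pow_ne_zero 2 (ne_of_gt hr)) (pow_ne_zero 2 (radialWeight_pos hr).ne')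
        exact (hc.aemeasurable measurableSet_Ioi).ennreal_ofReal
    _ ≤ (9 * 2) * 2 := by
        refine mul_le_mul' ?_ ?_
        · have e : ∀ r : ℝ, ENNReal.ofReal (9 * (1 / (r ^ 2 * radialWeight r ^ 2))) = 9 * ENNReal.ofReal (1 / (r ^ 2 * radialWeight r ^ 2)) := fun r => by
            rw [ENNReal.ofReal_mul (by norm_num), ENNReal.ofReal_ofNat]
          simp_rw [e]
          rw [lintegral_const_mul' _ _ (by norm_num)]
          exact mul_le_mul_right lintegral_inv_sq_radialWeight_le _
        · rw [setLIntegral_const, Real.volume_Ioo, one_mul]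
          have h2 : π / 2 - 0 ≤ 2 := by linarith [Real.pi_lt_four]
          exact (ENNReal.ofReal_le_ofReal h2).trans (by rw [ENNReal.ofReal_ofNat 2])
    _ = 36 := by norm_num

/-- **Cauchy–Schwarz for the `L₁₂` integrand**: for `h` continuous on the strip and `z ≥ 0`,
`∫∫_{r>z} |hK/r| ≤ 6·|h|_{𝓗⁰}` (in `ℝ≥0∞`, `|h|²_{𝓗⁰} = eL2Sq (hkRadialTerm 0 h)`). [cite: Elgindi2021, §7.5 (p. 24 of arXiv:1904.04795)] -/
theorem lintegral_L12Integrand_le {h : ℝ → ℝ → ℝ} (hc : ContinuousOn (uncurry h) strip) {z : ℝ} (hz : 0 ≤ z) :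
    ∫⁻ p in L12Region z, ‖h p.1 p.2 * kernelK p.2 / p.1‖ₑ ≤ (eL2Sq (hkRadialTerm 0 h)) ^ (1 / 2 : ℝ) * 6 := by
  have hsub := L12Region_subset_strip hz
  set f : ℝ × ℝ → ℝ≥0∞ := fun p => ENNReal.ofReal |h p.1 p.2 * hWeight p.1 p.2| with hf
  set g : ℝ × ℝ → ℝ≥0∞ := fun p => ENNReal.ofReal |kernelK p.2 / (p.1 * hWeight p.1 p.2)| with hg
  have mh : ContinuousOn (fun p : ℝ × ℝ => h p.1 p.2) strip := hc
  have mf : AEMeasurable f (volume.restrict strip) :=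
    ((continuous_abs.comp_continuousOn (mh.mul continuousOn_hWeight)).aemeasurable measurableSet_strip).ennreal_ofReal
  have mg : AEMeasurable g (volume.restrict strip) := by
    have hcg : ContinuousOn (fun p : ℝ × ℝ => kernelK p.2 / (p.1 * hWeight p.1 p.2)) strip :=
      (continuous_kernelK.comp_continuousOn continuousOn_snd).div (continuousOn_fst.mul continuousOn_hWeight) fun p hp =>
        mul_ne_zero (ne_of_gt hp.1) (lt_of_lt_of_le (radialWeight_pos hp.1) (radialWeight_le_hWeight hp)).ne'
    exact ((continuous_abs.comp_continuousOn hcg).aemeasurable measurableSet_strip).ennreal_ofReal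
  have hH := ENNReal.lintegral_mul_le_Lp_mul_Lq (volume.restrict strip) Real.HolderConjugate.two_two mf mg
  have e2 : ∀ (x : ℝ), ENNReal.ofReal |x| ^ (2:ℝ) = ENNReal.ofReal (x ^ 2) := fun x => by
    rw [show (2:ℝ) = ((2:ℕ) : ℝ) by norm_num, ENNReal.rpow_natCast, ← ENNReal.ofReal_pow (abs_nonneg _), sq_abs]
  have eF : ∫⁻ p in strip, f p ^ (2:ℝ) = eL2Sq (hkRadialTerm 0 h) := by
    rw [eL2Sq_eq_lintegral_ofReal]
    refine lintegral_congr fun p => ?_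
    simp only [hf, e2, hkRadialTerm, Function.iterate_zero, id_eq]
  have eG : ∫⁻ p in strip, g p ^ (2:ℝ) ≤ 36 := by
    refine le_trans (le_of_eq (lintegral_congr fun p => ?_)) lintegral_kernel_div_sq_le
    simp only [hg, e2]
  calc ∫⁻ p in L12Region z, ‖h p.1 p.2 * kernelK p.2 / p.1‖ₑ ≤ ∫⁻ p in strip, ‖h p.1 p.2 * kernelK p.2 / p.1‖ₑ := lintegral_mono_set hsub
    _ = ∫⁻ p in strip, (f * g) p := by
        refine setLIntegral_congr_fun measurableSet_strip fun p hp => ?_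
        have hr : p.1 ≠ 0 := ne_of_gt hp.1
        have hW : hWeight p.1 p.2 ≠ 0 := (lt_of_lt_of_le (radialWeight_pos hp.1) (radialWeight_le_hWeight hp)).ne'
        rw [Real.enorm_eq_ofReal_abs, Pi.mul_apply, hf, hg, ← ENNReal.ofReal_mul (abs_nonneg _), ← abs_mul]
        congr 2
        field_simp
    _ ≤ (∫⁻ p in strip, f p ^ (2:ℝ)) ^ (1 / (2:ℝ)) * (∫⁻ p in strip, g p ^ (2:ℝ)) ^ (1 / (2:ℝ)) := hH
    _ ≤ (eL2Sq (hkRadialTerm 0 h)) ^ (1 / 2 : ℝ) * (36:ℝ≥0∞) ^ (1 / 2 : ℝ) := by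
        rw [eF]; gcongr
    _ = (eL2Sq (hkRadialTerm 0 h)) ^ (1 / 2 : ℝ) * 6 := by
        congr 1
        rw [show (36:ℝ≥0∞) = 6 ^ 2 by norm_num, ← ENNReal.rpow_natCast, ← ENNReal.rpow_mul]; norm_num

/-- **Integrability of the `L₁₂` integrand** on `{r > z} × (0,π/2)`, `z ≥ 0`, for `h` continuous on
the strip with `|h|_{𝓗⁰} < ∞`. [cite: Elgindi2021, §1.7.2 (p. 7 of arXiv:1904.04795)] -/
theorem integrableOn_L12Integrand {h : ℝ → ℝ → ℝ} (hc : ContinuousOn (uncurry h) strip) (hfin : eL2Sq (hkRadialTerm 0 h) < ⊤)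
    {z : ℝ} (hz : 0 ≤ z) : IntegrableOn (fun p : ℝ × ℝ => h p.1 p.2 * kernelK p.2 / p.1) (L12Region z) volume := by
  have hsub := L12Region_subset_strip hz
  have mh : ContinuousOn (fun p : ℝ × ℝ => h p.1 p.2) strip := hc
  have hco : ContinuousOn (fun p : ℝ × ℝ => h p.1 p.2 * kernelK p.2 / p.1) (L12Region z) :=
    ((mh.mono hsub).mul (continuous_kernelK.comp_continuousOn continuousOn_snd)).div continuousOn_fst fun p hp => ne_of_gt (hsub hp).1
  refine ⟨hco.aestronglyMeasurable (measurableSet_L12Region z), ?_⟩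
  rw [hasFiniteIntegral_iff_enorm]
  refine lt_of_le_of_lt (lintegral_L12Integrand_le hc hz) ?_
  exact ENNReal.mul_lt_top (ENNReal.rpow_lt_top_of_nonneg (by norm_num) hfin.ne) (by norm_num)

/-- **`L₁₂` as a double integral** when the integrand is integrable. [cite: Elgindi2021, §1.7.2 (p. 7 of arXiv:1904.04795)] -/
theorem L12_eq_setIntegral {h : ℝ → ℝ → ℝ} {z : ℝ} (hint : IntegrableOn (fun p : ℝ × ℝ => h p.1 p.2 * kernelK p.2 / p.1) (L12Region z) volume) :
    L12 h z = ∫ p in L12Region z, h p.1 p.2 * kernelK p.2 / p.1 := by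
  rw [L12_def]
  have e : (volume.restrict (L12Region z) : Measure (ℝ × ℝ)) = (volume.restrict (Ioi z)).prod (volume.restrict (Ioo (0:ℝ) (π / 2))) := by
    rw [Measure.prod_restrict, ← Measure.volume_eq_prod]; rfl
  unfold IntegrableOn at hint
  rw [e] at hint
  rw [show (∫ p in L12Region z, h p.1 p.2 * kernelK p.2 / p.1) = ∫ p, h p.1 p.2 * kernelK p.2 / p.1 ∂(volume.restrict (L12Region z)) from rfl, e,
    integral_prod _ hint]

/-- **`|L₁₂(h)(z)| ≤ 6|h|_{𝓗⁰}`** for `h` continuous on the strip with `|h|_{𝓗⁰} < ∞`, `z ≥ 0`. [cite: Elgindi2021, §7.5 (p. 24 of arXiv:1904.04795)] -/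
theorem abs_L12_le_hk0 {h : ℝ → ℝ → ℝ} (hc : ContinuousOn (uncurry h) strip) (hfin : eL2Sq (hkRadialTerm 0 h) < ⊤) {z : ℝ} (hz : 0 ≤ z) :
    |L12 h z| ≤ ((eL2Sq (hkRadialTerm 0 h)) ^ (1 / 2 : ℝ) * 6).toReal := by
  rw [L12_eq_setIntegral (integrableOn_L12Integrand hc hfin hz)]
  refine (norm_integral_le_lintegral_norm (fun p : ℝ × ℝ => h p.1 p.2 * kernelK p.2 / p.1)).trans (ENNReal.toReal_mono ?_ ?_)
  · exact ENNReal.mul_ne_top (ENNReal.rpow_ne_top_of_nonneg (by norm_num) hfin.ne) (by norm_num)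
  · refine le_trans (le_of_eq (lintegral_congr fun p => ?_)) (lintegral_L12Integrand_le hc hz)
    rw [ofReal_norm]

/-- **Continuity of `L₁₂` along `𝓗⁴`-approximating sequences**: `L₁₂(f_n)(z) → L₁₂(F)(z)` for
`z ≥ 0`. [cite: Elgindi2021, §7.5 (p. 24 of arXiv:1904.04795)] -/
theorem HkApprox.tendsto_L12 {α : ℝ} {F : ℝ → ℝ → ℝ} {fs : ℕ → ℝ → ℝ → ℝ} (hA : HkApprox α F fs) {z : ℝ} (hz : 0 ≤ z) :
    Tendsto (fun n => L12 (fs n) z) atTop (𝓝 (L12 F z)) := by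
  have hFc : ContinuousOn (uncurry F) strip := hA.smooth.continuousOn
  have hfc : ∀ n, ContinuousOn (uncurry (fs n)) strip := fun n => ((hA.test n).smooth 0).continuous.continuousOn
  have hdc : ∀ n, ContinuousOn (uncurry (fs n - F)) strip := fun n => ((hfc n).sub hFc).congr fun p _ => rfl
  have h0 : ∀ (g : ℝ → ℝ → ℝ), eL2Sq (hkRadialTerm 0 g) ≤ eHkNormSq α 4 g := fun g => eL2Sq_hkRadialTerm_le α (by norm_num) g
  have hFfin : eL2Sq (hkRadialTerm 0 F) < ⊤ := lt_of_le_of_lt (h0 F) hA.eHkNormSq_lt_top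
  have hffin : ∀ n, eL2Sq (hkRadialTerm 0 (fs n)) < ⊤ := fun n => lt_of_le_of_lt (h0 _) (hA.test n).eHkNormSq_lt_top
  have hF4 : ContDiffOn ℝ 4 (uncurry F) strip :=
    hA.smooth.of_le (WithTop.coe_le_coe.2 le_top : (4 : WithTop ℕ∞) ≤ ((⊤ : ℕ∞) : WithTop ℕ∞))
  have hEfin : ∀ n, eHkNormSq α 4 (fs n - F) < ⊤ := by
    intro n
    have e : fs n - F = fs n + (-1 : ℝ) • F := by funext z θ; simp; ring
    rw [e]
    refine lt_of_le_of_lt (eHkNormSq_add_le ((hA.test n).smooth 4).contDiffOn (hF4.const_smul (-1 : ℝ))) ?_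
    rw [eHkNormSq_smul, Real.enorm_eq_ofReal_abs, abs_neg, abs_one, ENNReal.ofReal_one, one_pow, one_mul]
    exact ENNReal.add_lt_top.2 ⟨ENNReal.mul_lt_top (by norm_num) (hA.test n).eHkNormSq_lt_top, ENNReal.mul_lt_top (by norm_num) hA.eHkNormSq_lt_top⟩
  have hdfin : ∀ n, eL2Sq (hkRadialTerm 0 (fs n - F)) < ⊤ := fun n => lt_of_le_of_lt (h0 _) (hEfin n)
  -- `L₁₂(f_n)(z) − L₁₂(F)(z) = L₁₂(f_n − F)(z)`
  have hlin : ∀ n, L12 (fs n) z - L12 F z = L12 (fs n - F) z := by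
    intro n
    rw [L12_eq_setIntegral (integrableOn_L12Integrand (hfc n) (hffin n) hz), L12_eq_setIntegral (integrableOn_L12Integrand hFc hFfin hz),
      L12_eq_setIntegral (integrableOn_L12Integrand (hdc n) (hdfin n) hz), ← integral_sub (integrableOn_L12Integrand (hfc n) (hffin n) hz)
        (integrableOn_L12Integrand hFc hFfin hz)]
    refine integral_congr_ae (ae_of_all _ fun p => ?_)
    simp only [Pi.sub_apply]; ring
  have hb : ∀ n, ‖L12 (fs n) z - L12 F z‖ ≤ ((eHkNormSq α 4 (fs n - F)) ^ (1 / 2 : ℝ) * 6).toReal := by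
    intro n
    rw [Real.norm_eq_abs, hlin n]
    refine (abs_L12_le_hk0 (hdc n) (hdfin n) hz).trans (ENNReal.toReal_mono ?_ ?_)
    · exact ENNReal.mul_ne_top (ENNReal.rpow_ne_top_of_nonneg (by norm_num) (hEfin n).ne) (by norm_num)
    · gcongr; exact h0 _
  have hT : Tendsto (fun n => ((eHkNormSq α 4 (fs n - F)) ^ (1 / 2 : ℝ) * 6).toReal) atTop (𝓝 0) := by
    have h1 : Tendsto (fun n => (eHkNormSq α 4 (fs n - F)) ^ (1 / 2 : ℝ) * 6) atTop (𝓝 0) := by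
      have h2 := ((ENNReal.continuous_rpow_const (y := (1 / 2 : ℝ))).tendsto (0:ℝ≥0∞)).comp hA.conv
      rw [ENNReal.zero_rpow_of_pos (by norm_num : (0:ℝ) < 1 / 2)] at h2
      have := ENNReal.Tendsto.mul_const h2 (Or.inr (by norm_num : (6:ℝ≥0∞) ≠ ⊤))
      rwa [zero_mul] at this
    rw [← ENNReal.toReal_zero]
    exact (ENNReal.tendsto_toReal ENNReal.zero_ne_top).comp h1
  exact tendsto_sub_nhds_zero_iff.1 (squeeze_zero_norm hb hT)

end Elgindi

end Literature.Analysis.FluidPDE
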